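import Summits.AnomalousDissipation.AnomalousDissipation.Theorems.SoloBlindErgodicRealisation
import Literature.Analysis.FluidPDE.DoeringFoiasPowerProofs

/-!
# Solo (blind) — ergodic realisation, mean form: `ZerothLaw` from ensembles with MEAN bounds only

`SoloBlindErgodicRealisation` realises `Literature.Turb.ZerothLaw` from stationary ensembles of
Leray–Hopf paths whose unit-window energy is bounded along a.e. path (or which are ergodic). Here
the hypotheses are the ones a statistical statement of the zeroth law actually makes: only the
ENSEMBLE MEANS `∫(∫₀¹‖u‖₂²)dμ ≤ E` and `∫(∫₀¹ν‖∇u‖₂²)dμ ≥ ε > 0`, no ergodicity. The price is in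
the constants: some path has `meanEnergy ≤ 16‖f‖₂²E²/ε²` and `meanDissipation ≥ ε/2`.

The extra input is the pathwise Leray–Hopf bound `⟨ν‖∇u‖₂²⟩_T ≤ ½‖u(0)‖₂²/T + ‖f‖₂ √⟨‖u‖₂²⟩_T`
(energy inequality from `0` + Cauchy–Schwarz/Jensen, tree `abs_timeMean_power_le`), which in the
limit gives `d* ≤ ‖f‖₂ √e*` for the Birkhoff limits a.e.; a Chebyshev-type selection then finds a
path with `e* ≤ 16‖f‖₂²E²/ε²` and `d* ≥ ε/2` (`frequently_le_and_ge_of_integral_bounds`).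

* `lhPath_timeMean_dissipation_le` — the pathwise bound.
* `frequently_le_and_ge_of_integral_bounds` — the selection lemma (pure measure theory).
* `exists_witnessPath_of_meanEnsemble` — the realisation theorem, mean form.
* `zerothLaw_of_meanLHEnsembles` — the door: `ZerothLaw` from stationary Leray–Hopf ensembles
  with uniformly bounded mean energy and mean dissipation bounded below, along `ν_j → 0⁺`.

[folklore] [cite: DajaniKalle2021, Thm 3.1.1] [cite: DoeringFoias2002, §2]
[cite: FoiasManleyRosaTemam2001, Ch. IV §3]
-/

open MeasureTheory Filter Topology Set
open scoped ENNReal NNReal RealInnerProductSpace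

noncomputable section

namespace Summit.AnomalousDissipation.AnomalousDissipation.Theorems

open Literature.Analysis.FunctionSpaces Literature.Analysis.FunctionSpaces.Torus
open Literature.Analysis.FluidPDE

/-! ### Pathwise: dissipation mean against energy mean -/

section Path

variable {ν : ℝ} {f u₀ : UnitAddTorus (Fin 3) → EuclideanSpace ℝ (Fin 3)}
  {u : ℝ → UnitAddTorus (Fin 3) → EuclideanSpace ℝ (Fin 3)}

/-- **`⟨ν‖∇u‖₂²⟩_T ≤ ½‖u₀‖₂²/T + ‖f‖₂ √⟨‖u‖₂²⟩_T`** along every global Leray–Hopf solution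
(`ν ≥ 0`, `T > 0`): the energy inequality from `0` bounds the dissipated energy by the initial
energy plus the injected work, and the work is at most `‖f‖₂ T √⟨‖u‖₂²⟩_T`.
[cite: DoeringFoias2002, §2] [cite: Leray1934, (5.2)] -/
theorem lhPath_timeMean_dissipation_le (hu : Torus.IsGlobalLerayHopf ν (fun _ => f) u₀ u)
    (hf : IsSmooth f) {T : ℝ} (hT : 0 < T) :
    timeMean (fun t => ν * (eGradNormSq (u t)).toReal) T ≤
      kineticEnergy u₀ / T +
        Real.sqrt (∫ x, ‖f x‖ ^ 2) * Real.sqrt (timeMean (fun t => ∫ x, ‖u t x‖ ^ 2) T) := by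
  set B : ℝ := Real.sqrt (∫ x, ‖f x‖ ^ 2) * Real.sqrt (timeMean (fun t => ∫ x, ‖u t x‖ ^ 2) T)
    with hB
  have hen := (hu T hT).energy_ineq_zero T ⟨hT.le, le_rfl⟩
  have hD : ∫ t in (0 : ℝ)..T, ν * (eGradNormSq (u t)).toReal =
      ν * (∫⁻ τ in Ioo 0 T, eGradNormSq (u τ)).toReal := by
    rw [intervalIntegral.integral_const_mul, intervalIntegral.integral_of_le hT.le,
      (hu.setIntegral_toReal_eGradNormSq (s := 0) (t := T) le_rfl).2]
  have hP : ∫ τ in (0 : ℝ)..T, ∫ x, ⟪f x, u τ x⟫ =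
      T * timeMean (fun t => ∫ x, ⟪f x, u t x⟫) T := by
    unfold timeMean; rw [← mul_assoc, mul_inv_cancel₀ hT.ne', one_mul]
  have hPle : timeMean (fun t => ∫ x, ⟪f x, u t x⟫) T ≤ B :=
    (le_abs_self _).trans (hu.abs_timeMean_power_le hf hT)
  have hkT : 0 ≤ kineticEnergy (u T) := kineticEnergy_nonneg _
  have hDle : ∫ t in (0 : ℝ)..T, ν * (eGradNormSq (u t)).toReal ≤ kineticEnergy u₀ + T * B := by
    rw [hD]
    have h1 : T * timeMean (fun t => ∫ x, ⟪f x, u t x⟫) T ≤ T * B :=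
      mul_le_mul_of_nonneg_left hPle hT.le
    linarith
  calc timeMean (fun t => ν * (eGradNormSq (u t)).toReal) T
        = T⁻¹ * ∫ t in (0 : ℝ)..T, ν * (eGradNormSq (u t)).toReal := rfl
    _ ≤ T⁻¹ * (kineticEnergy u₀ + T * B) := mul_le_mul_of_nonneg_left hDle (inv_nonneg.mpr hT.le)
    _ = kineticEnergy u₀ / T + B := by
        rw [mul_add, div_eq_inv_mul, ← mul_assoc, inv_mul_cancel₀ hT.ne', one_mul]

end Path

/-! ### Selection: a Chebyshev-type lemma -/

section Selection

variable {Ω : Type*} [MeasurableSpace Ω] {μ : Measure Ω} [IsProbabilityMeasure μ]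

/-- If `X ≥ 0` has mean `≤ E`, `Y ≤ F√X` has mean `≥ ε > 0` (`F ≥ 0`), then on a non-null set
`X ≤ 16F²E²/ε²` and `Y ≥ ε/2`: otherwise `Y ≤ ε/2 + (ε/4E)·X` a.e. (the second term dominating
`F√X` where `X > 16F²E²/ε²`), whose mean is `≤ 3ε/4 < ε`. [folklore] -/
theorem frequently_le_and_ge_of_integral_bounds {X Y : Ω → ℝ} {F E ε : ℝ} (hF : 0 ≤ F)
    (hε : 0 < ε) (hX : Integrable X μ) (hY : Integrable Y μ) (hX0 : 0 ≤ᵐ[μ] X)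
    (hYX : ∀ᵐ ω ∂μ, Y ω ≤ F * Real.sqrt (X ω)) (hXE : ∫ ω, X ω ∂μ ≤ E)
    (hYε : ε ≤ ∫ ω, Y ω ∂μ) :
    ∃ᵐ ω ∂μ, X ω ≤ 16 * F ^ 2 * E ^ 2 / ε ^ 2 ∧ ε / 2 ≤ Y ω := by
  by_contra hcon
  rw [Filter.not_frequently] at hcon
  rcases le_or_gt E 0 with hE | hE
  · have hint0 : ∫ ω, X ω ∂μ = 0 := le_antisymm (hXE.trans hE) (integral_nonneg_of_ae hX0)
    have hXz : X =ᵐ[μ] 0 := (integral_eq_zero_iff_of_nonneg_ae hX0 hX).1 hint0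
    have hY0 : Y ≤ᵐ[μ] fun _ => (0 : ℝ) := by
      filter_upwards [hYX, hXz] with ω h1 h2
      rw [h2, Pi.zero_apply, Real.sqrt_zero, mul_zero] at h1
      exact h1
    have h3 : ∫ ω, Y ω ∂μ ≤ ∫ ω, (fun _ => (0 : ℝ)) ω ∂μ :=
      integral_mono_ae hY (integrable_const _) hY0
    simp only [integral_zero] at h3
    linarith
  · set K : ℝ := 16 * F ^ 2 * E ^ 2 / ε ^ 2 with hK
    have hK' : (4 * F * E / ε) ^ 2 = K := by rw [hK]; field_simp; ring
    have hptw : ∀ᵐ ω ∂μ, Y ω ≤ ε / 2 + (ε / (4 * E)) * X ω := by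
      filter_upwards [hcon, hYX, hX0] with ω hω hYXω hX0ω
      have hX0ω : 0 ≤ X ω := hX0ω
      have hc : 0 ≤ (ε / (4 * E)) * X ω := by positivity
      by_cases hx : X ω ≤ K
      · have hy : Y ω < ε / 2 := by
          by_contra h
          exact hω ⟨hx, not_lt.mp h⟩
        linarith
      · rw [not_le] at hx
        have hs : 4 * F * E / ε < Real.sqrt (X ω) := by
          rw [Real.lt_sqrt (by positivity), hK']
          exact hx
        have hsx : Real.sqrt (X ω) * Real.sqrt (X ω) = X ω := Real.mul_self_sqrt hX0ω
        have h2 : (ε / (4 * E)) * (4 * F * E / ε) = F := by field_simp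
        have h1 : F * Real.sqrt (X ω) ≤ (ε / (4 * E)) * X ω := by
          have h4 : (ε / (4 * E)) * (4 * F * E / ε) * Real.sqrt (X ω) ≤
              (ε / (4 * E)) * Real.sqrt (X ω) * Real.sqrt (X ω) := by
            have h5 : 0 ≤ (ε / (4 * E)) * Real.sqrt (X ω) := by positivity
            nlinarith [Real.sqrt_nonneg (X ω)]
          rw [h2] at h4
          calc F * Real.sqrt (X ω) ≤ (ε / (4 * E)) * Real.sqrt (X ω) * Real.sqrt (X ω) := h4
            _ = (ε / (4 * E)) * X ω := by rw [mul_assoc, hsx]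
        have h6 : 0 < ε / 2 := by positivity
        linarith
    have hI : ∫ ω, Y ω ∂μ ≤ ∫ ω, (ε / 2 + (ε / (4 * E)) * X ω) ∂μ :=
      integral_mono_ae hY ((integrable_const _).add (hX.const_mul _)) hptw
    have hI2 : ∫ ω, (ε / 2 + (ε / (4 * E)) * X ω) ∂μ = ε / 2 + (ε / (4 * E)) * ∫ ω, X ω ∂μ := by
      rw [integral_add (integrable_const _) (hX.const_mul _), integral_const_mul]
      simp
    have h3 : (ε / (4 * E)) * ∫ ω, X ω ∂μ ≤ ε / 4 :=
      calc (ε / (4 * E)) * ∫ ω, X ω ∂μ ≤ (ε / (4 * E)) * E :=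
            mul_le_mul_of_nonneg_left hXE (by positivity)
        _ = ε / 4 := by field_simp
    linarith

end Selection

/-! ### The realisation theorem, mean form -/

section Realisation

variable {Ω : Type*} [MeasurableSpace Ω] {μ : Measure Ω} [IsProbabilityMeasure μ] {S : Ω → Ω}
  {ν E ε : ℝ} {f : UnitAddTorus (Fin 3) → EuclideanSpace ℝ (Fin 3)}
  {Φ : Ω → ℝ → UnitAddTorus (Fin 3) → EuclideanSpace ℝ (Fin 3)}

/-- **Ergodic realisation, mean form.** A stationary ensemble of global Leray–Hopf paths of
`NS_ν(f)` (`ν ≥ 0`, `f` smooth) with ensemble-mean unit-window energy `≤ E` and ensemble-mean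
unit-window viscous dissipation `≥ ε > 0` contains a path with `meanEnergy ≤ 16‖f‖₂²E²/ε²` and
`meanDissipation ≥ ε/2` (both long-time means genuine limits along it). [folklore] -/
theorem exists_witnessPath_of_meanEnsemble (hS : MeasurePreserving S μ μ) (hν : 0 ≤ ν)
    (hf : IsSmooth f) (hε : 0 < ε)
    (hLH : ∀ ω, Torus.IsGlobalLerayHopf ν (fun _ => f) (Φ ω 0) (Φ ω))
    (hshift : ∀ ω t, Φ (S ω) t = Φ ω (t + 1))
    (hEint : Integrable (fun ω => ∫ t in (0 : ℝ)..1, ∫ x, ‖Φ ω t x‖ ^ 2) μ)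
    (hEle : ∫ ω, (∫ t in (0 : ℝ)..1, ∫ x, ‖Φ ω t x‖ ^ 2) ∂μ ≤ E)
    (hDint : Integrable (fun ω => ∫ t in (0 : ℝ)..1, ν * (eGradNormSq (Φ ω t)).toReal) μ)
    (hDge : ε ≤ ∫ ω, (∫ t in (0 : ℝ)..1, ν * (eGradNormSq (Φ ω t)).toReal) ∂μ) :
    ∃ ω, meanEnergy (Φ ω) ≤ 16 * (∫ x, ‖f x‖ ^ 2) * E ^ 2 / ε ^ 2 ∧
      ε / 2 ≤ meanDissipation ν (Φ ω) := by
  set eW : Ω → ℝ := fun ω => ∫ t in (0 : ℝ)..1, ∫ x, ‖Φ ω t x‖ ^ 2 with heW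
  set dW : Ω → ℝ := fun ω => ∫ t in (0 : ℝ)..1, ν * (eGradNormSq (Φ ω t)).toReal with hdW
  set F : ℝ := Real.sqrt (∫ x, ‖f x‖ ^ 2) with hFdef
  have hF0 : 0 ≤ F := Real.sqrt_nonneg _
  have hF2 : F ^ 2 = ∫ x, ‖f x‖ ^ 2 := Real.sq_sqrt (integral_nonneg fun _ => by positivity)
  have hI := MeasurableSpace.invariants_le S
  have hconvE : ∀ᵐ ω ∂μ, Tendsto (timeMean fun t => ∫ x, ‖Φ ω t x‖ ^ 2) atTop
      (𝓝 ((μ[eW|MeasurableSpace.invariants S]) ω)) :=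
    ae_timeMean_tendsto_condExp_invariants (g := fun ω t => ∫ x, ‖Φ ω t x‖ ^ 2) hS
      (fun ω t => by simp [hshift ω t]) (fun ω t _ => integral_nonneg fun x => sq_nonneg _)
      (fun ω a b ha hab => lhPath_intervalIntegrable_energy (hLH ω) ha hab) hEint
  have hconvD : ∀ᵐ ω ∂μ, Tendsto (timeMean fun t => ν * (eGradNormSq (Φ ω t)).toReal) atTop
      (𝓝 ((μ[dW|MeasurableSpace.invariants S]) ω)) :=
    ae_timeMean_tendsto_condExp_invariants (g := fun ω t => ν * (eGradNormSq (Φ ω t)).toReal) hS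
      (fun ω t => by simp [hshift ω t]) (fun ω t _ => mul_nonneg hν ENNReal.toReal_nonneg)
      (fun ω a b ha hab => lhPath_intervalIntegrable_dissipation (hLH ω) ha hab) hDint
  -- pathwise limit inequality `d* ≤ F √e*`
  have hYX : ∀ᵐ ω ∂μ, (μ[dW|MeasurableSpace.invariants S]) ω ≤
      F * Real.sqrt ((μ[eW|MeasurableSpace.invariants S]) ω) := by
    filter_upwards [hconvE, hconvD] with ω hE hD
    have hR : Tendsto (fun T : ℝ => kineticEnergy (Φ ω 0) / T +
        F * Real.sqrt (timeMean (fun t => ∫ x, ‖Φ ω t x‖ ^ 2) T)) atTop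
        (𝓝 (0 + F * Real.sqrt ((μ[eW|MeasurableSpace.invariants S]) ω))) :=
      (tendsto_const_nhds.div_atTop tendsto_id).add (hE.sqrt.const_mul F)
    rw [zero_add] at hR
    exact le_of_tendsto_of_tendsto hD hR (by
      filter_upwards [eventually_gt_atTop (0 : ℝ)] with T hT
      exact lhPath_timeMean_dissipation_le (hLH ω) hf hT)
  have hX0 : 0 ≤ᵐ[μ] μ[eW|MeasurableSpace.invariants S] :=
    condExp_nonneg (ae_of_all μ fun ω => intervalIntegral.integral_nonneg zero_le_one
      fun t _ => integral_nonneg fun x => sq_nonneg _)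
  have hXE : ∫ ω, (μ[eW|MeasurableSpace.invariants S]) ω ∂μ ≤ E := by
    rw [integral_condExp hI]; exact hEle
  have hYε : ε ≤ ∫ ω, (μ[dW|MeasurableSpace.invariants S]) ω ∂μ := by
    rw [integral_condExp hI]; exact hDge
  have hsel := frequently_le_and_ge_of_integral_bounds hF0 hε integrable_condExp integrable_condExp
    hX0 hYX hXE hYε
  rw [hF2] at hsel
  obtain ⟨ω, ⟨hω1, hω2⟩, hω3, hω4⟩ := ((hconvE.and hconvD).and_frequently hsel).exists
  refine ⟨ω, ?_, ?_⟩
  · change limsup (timeMean fun t => ∫ x, ‖Φ ω t x‖ ^ 2) atTop ≤ _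
    rw [hω1.limsup_eq]; exact hω3
  · change ε / 2 ≤ limsup (timeMean fun t => ν * (eGradNormSq (Φ ω t)).toReal) atTop
    rw [hω2.limsup_eq]; exact hω4

end Realisation

/-! ### The door, mean form -/

/-- **Door: `ZerothLaw` from stationary ensembles with mean bounds (statistical zeroth law ⇒
zeroth law).** One admissible force, `ν_j → 0⁺`, `ε > 0`, `E`; for every `j` a stationary
ensemble of Leray–Hopf paths of `NS_{ν_j}(f)` with MEAN unit-window energy `≤ E` and MEAN
unit-window viscous dissipation `≥ ε`. Then `ZerothLaw` holds, with energy bound `16‖f‖₂²E²/ε²`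
and dissipation floor `ε/2` (`exists_witnessPath_of_meanEnsemble`). [folklore] -/
theorem zerothLaw_of_meanLHEnsembles {f : UnitAddTorus (Fin 3) → EuclideanSpace ℝ (Fin 3)}
    (hf : IsSmooth f) (hfdiv : IsDivFree f) (hf0 : HasZeroMean f) {ν : ℕ → ℝ} (hν : ∀ j, 0 < ν j)
    (hν0 : Tendsto ν atTop (𝓝 0)) {E ε : ℝ} (hε : 0 < ε)
    (hens : ∀ j, ∃ (Ω : Type) (_ : MeasurableSpace Ω) (μ : Measure Ω) (_ : IsProbabilityMeasure μ)
      (S : Ω → Ω) (Φ : Ω → ℝ → UnitAddTorus (Fin 3) → EuclideanSpace ℝ (Fin 3)),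
      MeasurePreserving S μ μ ∧ (∀ ω, Torus.IsGlobalLerayHopf (ν j) (fun _ => f) (Φ ω 0) (Φ ω)) ∧
        (∀ ω t, Φ (S ω) t = Φ ω (t + 1)) ∧
        Integrable (fun ω => ∫ t in (0 : ℝ)..1, ∫ x, ‖Φ ω t x‖ ^ 2) μ ∧
        (∫ ω, (∫ t in (0 : ℝ)..1, ∫ x, ‖Φ ω t x‖ ^ 2) ∂μ ≤ E) ∧
        Integrable (fun ω => ∫ t in (0 : ℝ)..1, ν j * (eGradNormSq (Φ ω t)).toReal) μ ∧
        ε ≤ ∫ ω, (∫ t in (0 : ℝ)..1, ν j * (eGradNormSq (Φ ω t)).toReal) ∂μ) :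
    Literature.Turb.ZerothLaw := by
  have hw : ∀ j, ∃ u : ℝ → UnitAddTorus (Fin 3) → EuclideanSpace ℝ (Fin 3),
      Torus.IsGlobalLerayHopf (ν j) (fun _ => f) (u 0) u ∧
        meanEnergy u ≤ 16 * (∫ x, ‖f x‖ ^ 2) * E ^ 2 / ε ^ 2 ∧
        ε / 2 ≤ meanDissipation (ν j) u := by
    intro j
    obtain ⟨Ω, _, μ, _, S, Φ, hS, hLH, hshift, hEint, hEle, hDint, hDge⟩ := hens j
    obtain ⟨ω, hω1, hω2⟩ :=
      exists_witnessPath_of_meanEnsemble hS (hν j).le hf hε hLH hshift hEint hEle hDint hDge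
    exact ⟨Φ ω, hLH ω, hω1, hω2⟩
  choose u hu using hw
  exact ⟨f, hf, hfdiv, hf0, ν, fun j => u j 0, u, hν, hν0, fun j => (hu j).1,
    ⟨16 * (∫ x, ‖f x‖ ^ 2) * E ^ 2 / ε ^ 2, fun j => (hu j).2.1⟩, ε / 2, by positivity,
    fun j => (hu j).2.2⟩

end Summit.AnomalousDissipation.AnomalousDissipation.Theorems

end
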